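import Summits.CriticalPhenomena.PercolationContinuityZ3.Theorems.PercNearOneGluingNoHeavyLowerTailSahiPair43LinkFinal
import Summits.CriticalPhenomena.PercolationContinuityZ3.Theorems.PercNearOneGluingNoHeavyLowerTailSahiSlotPatternThree
import Summits.CriticalPhenomena.PercolationContinuityZ3.Theorems.SahiGridPatternOrderNThree
import Summits.CriticalPhenomena.PercolationContinuityZ3.Theorems.PercNearOneGluingNoHeavyLowerTailSahiPair43Chunk0
import Summits.CriticalPhenomena.PercolationContinuityZ3.Theorems.PercNearOneGluingNoHeavyLowerTailSahiPair43Chunk1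
import Summits.CriticalPhenomena.PercolationContinuityZ3.Theorems.PercNearOneGluingNoHeavyLowerTailSahiPair43Chunk2
import Summits.CriticalPhenomena.PercolationContinuityZ3.Theorems.PercNearOneGluingNoHeavyLowerTailSahiPair43Chunk3
import Summits.CriticalPhenomena.PercolationContinuityZ3.Theorems.PercNearOneGluingNoHeavyLowerTailSahiPair43Chunk4
import Summits.CriticalPhenomena.PercolationContinuityZ3.Theorems.PercNearOneGluingNoHeavyLowerTailSahiPair43Chunk5
import Summits.CriticalPhenomena.PercolationContinuityZ3.Theorems.PercNearOneGluingNoHeavyLowerTailSahiPair43Chunk6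
import Summits.CriticalPhenomena.PercolationContinuityZ3.Theorems.PercNearOneGluingNoHeavyLowerTailSahiPair43Chunk7
import Summits.CriticalPhenomena.PercolationContinuityZ3.Theorems.PercNearOneGluingNoHeavyLowerTailSahiPair43Chunk8
import Summits.CriticalPhenomena.PercolationContinuityZ3.Theorems.PercNearOneGluingNoHeavyLowerTailSahiPair43Chunk9
import Summits.CriticalPhenomena.PercolationContinuityZ3.Theorems.PercNearOneGluingNoHeavyLowerTailSahiPair43Chunk10
import Summits.CriticalPhenomena.PercolationContinuityZ3.Theorems.PercNearOneGluingNoHeavyLowerTailSahiPair43Chunk11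
import Summits.CriticalPhenomena.PercolationContinuityZ3.Theorems.PercNearOneGluingNoHeavyLowerTailSahiPair43Chunk12
import Summits.CriticalPhenomena.PercolationContinuityZ3.Theorems.PercNearOneGluingNoHeavyLowerTailSahiPair43Chunk13
import Summits.CriticalPhenomena.PercolationContinuityZ3.Theorems.PercNearOneGluingNoHeavyLowerTailSahiPair43Chunk14
import Summits.CriticalPhenomena.PercolationContinuityZ3.Theorems.PercNearOneGluingNoHeavyLowerTailSahiPair43Chunk15
import Summits.CriticalPhenomena.PercolationContinuityZ3.Theorems.PercNearOneGluingNoHeavyLowerTailSahiPair43Chunk16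
import Summits.CriticalPhenomena.PercolationContinuityZ3.Theorems.PercNearOneGluingNoHeavyLowerTailSahiPair43Chunk17
import Summits.CriticalPhenomena.PercolationContinuityZ3.Theorems.PercNearOneGluingNoHeavyLowerTailSahiPair43Chunk18
import Summits.CriticalPhenomena.PercolationContinuityZ3.Theorems.PercNearOneGluingNoHeavyLowerTailSahiPair43Chunk19

/-!
# THE CELL `(4,3)` OF THE SAHI WIDTH PHASE DIAGRAM IN THE KERNEL: **`PatternPos 4`** — Kahn's `C₃` (Sahi's `E₃ ≥ 0`) for every
# product / FKG probability weight on every four-dimensional grid, and Lieb–Sahi on `[0,1]^4` at order 3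

Support file (Sahi cell `prim-sahi`, seat `prim-sahi-typer` gen 31–32; `--supports stmt-CriticalPhenomena-4575`).  Pure proofs; closure =
standard axioms + the `native_decide` axioms of the twenty computational chunks `…SahiPair43Chunk0 … Chunk19` (one evaluation
`chunkCheck 20 r = true` each, ≈ 300 s on the farm).

THE PROOF (all in the tree).  `…SahiPairSaturation` (every `d`): `PatternPos d` follows if the y-profile of every MUTUALLY SATURATED pair of
up-sets (`PairCond`) lies in the dual cone of the up-sets (`patternPos_of_pairCond`: normal form of a triple under the two monotone moves,
potential argument).  `…SahiPair43Check/CheckPacked` (computable): the checker `chunkCheck m r` enumerates the antichains `N` of `[3]^4` with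
sorted axis signature and hash `≡ r (mod m)`, all their 2-colourings `N = coGen A ⊔ coGen B` passing the class-size and minimal-element
filters, and tests the y-profile of `(A, B)` by an oblivious greedy downward transport on 1024-lane big-integer vectors, falling back to a
one-pair greedy/max-flow transport.  SOUNDNESS (`…Pair43Lanes/LinkScalar/LinkProfile/LinkGreedy/LinkTables/LinkWalk/LinkNodePrelim/
LinkNode/LinkSym/LinkFinal`, standard axioms): the lane arithmetic is exact (`satsub_eq`, `lmin_eq`), the packed profile is the y-profile
(`profN_eq`), every transport step is a downward transfer (`inDual_of_transfer`) so `packedTest` is sound (`packedTest_sound`), the walk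
visits every admissible node and the batch pipeline loses nothing (`walk_spec`, `chunkCheck_sound`), every `PairCond` pair — after sorting
its signature by an axis permutation (`Tuple.sort`, `pairCond_map`, `inDual_of_map`) and possibly swapping the two sets — is a colouring
that the checker pushes (`maskSet_pairA/B`, `pushed_of_pairCond`), whence `patternPos_four_of_chunks`.  THIS FILE: the twenty chunks
give `chunkCheck 20 r = true` for all `r < 20`, hence
* **`patternPos_four : PatternPos 4`** and `patternPos_of_le_four`;
* the layer corollaries (existing all-`d` reductions of `…SahiGridPattern`): `liebSahi_grid_four` (every product probability weight on every
  grid `[K+1]^4` is Sahi-positive of order 3 — Kahn's Conjecture 5 / Sahi's `C₃` in dimension 4), `fkg_grid_four` (every FKG weight on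
  `[b+1]^4`), `sahiPositive_three_of_latticeEmbedding_four` (every FKG weight on a finite distributive lattice of J-width `≤ 4`),
  `liebSahiContinuum_four_three` (Lieb–Sahi Conjecture 1.1 on `[0,1]^4` at order 3), `slotPatternPos_four_three`, `patternPosN_three_four`.
Previously `PatternPos d` was proved for `d ≤ 3` only (`patternPos_of_le_three`); `d = 4` had certificate/census evidence (p1 gen 8 LP slice
certificates; coloured-antichain censuses; kit j190176).  HONEST LABEL: computational (20 `native_decide` evaluations); the reduction and
the checker's soundness are kernel-checked with standard axioms. [this work] [computational]
-/

namespace Summit.CriticalPhenomena.PercolationContinuityZ3.Theorems.SahiGridPattern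

open Finset Literature.Probability.LatticeModels Literature.Combinatorics.Sahi2008
open Pair43

/-- **All twenty chunks of the pair-saturation check pass.** [this work] [computational] -/
theorem chunkCheck_twenty_all : ∀ r < 20, chunkCheck 20 r = true := by
  intro r hr
  interval_cases r
  exacts [chunkCheck_20_0, chunkCheck_20_1, chunkCheck_20_2, chunkCheck_20_3, chunkCheck_20_4, chunkCheck_20_5, chunkCheck_20_6, chunkCheck_20_7, chunkCheck_20_8, chunkCheck_20_9, chunkCheck_20_10, chunkCheck_20_11, chunkCheck_20_12, chunkCheck_20_13, chunkCheck_20_14, chunkCheck_20_15, chunkCheck_20_16, chunkCheck_20_17, chunkCheck_20_18, chunkCheck_20_19]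

/-- **`PatternPos 4`** — THE `[3]^4` PATTERN INEQUALITY: `sStarD A B C ≥ 0` for all up-sets `A, B, C` of `[3]^4` (the cell `(4,3)` of the
width phase diagram). [this work] [computational] -/
theorem patternPos_four : PatternPos 4 :=
  patternPos_four_of_chunks (m := 20) (by norm_num) chunkCheck_twenty_all

/-- `PatternPos d` for every `d ≤ 4`. [this work] [computational] -/
theorem patternPos_of_le_four {d : ℕ} (hd : d ≤ 4) : PatternPos d :=
  patternPos_of_le hd patternPos_four

/-- **Kahn's Conjecture 5 / Sahi's `C₃` in dimension 4**: every product probability weight on every grid `[K+1]^4` is Sahi-positive of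
order 3 (`E₃(f,g,h) ≥ 0` for nonnegative increasing `f, g, h`). [this work] [computational] -/
theorem liebSahi_grid_four : ∀ (K : ℕ) (g : Fin 4 → Fin (K + 1) → ℝ), (∀ i u, 0 ≤ g i u) → (∀ i, ∑ u, g i u = 1) →
    SahiPositive (fun ω : Fin 4 → Fin (K + 1) => ∏ i, g i (ω i)) 3 :=
  liebSahi_grid_of_patternPos patternPos_four

/-- **Every FKG probability weight on every grid `[b+1]^4` is Sahi-positive of order 3.** [this work] [computational] -/
theorem fkg_grid_four : ∀ (b : ℕ) (μ : (Fin 4 → Fin (b + 1)) → ℝ), IsFKGMeasure μ → SahiPositive μ 3 :=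
  fkg_grid_of_patternPos patternPos_four

/-- Sahi's `C₃` for every FKG weight on every finite distributive lattice with a lattice embedding into a four-dimensional grid
(J-width `≤ 4`). [this work] [computational] -/
theorem sahiPositive_three_of_latticeEmbedding_four {L : Type*} [DistribLattice L] [Fintype L] [DecidableEq L] {b : ℕ}
    (e : L → (Fin 4 → Fin (b + 1))) (he : Function.Injective e) (hinf : ∀ x y, e (x ⊓ y) = e x ⊓ e y)
    (hsup : ∀ x y, e (x ⊔ y) = e x ⊔ e y) {μ : L → ℝ} (hμ : IsFKGMeasure μ) : SahiPositive μ 3 :=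
  sahiPositive_three_of_latticeEmbedding_of_patternPos patternPos_four e he hinf hsup hμ

/-- **Lieb–Sahi's Conjecture 1.1 on `[0,1]^4` at order 3** (Lebesgue measure, bounded measurable coordinatewise increasing functions).
[this work] [computational] -/
theorem liebSahiContinuum_four_three : LiebSahiContinuum 4 3 :=
  liebSahiContinuum_of_patternPos patternPos_four

/-- The cell `(4,3)` in the slot-pattern language of the order-`n` programme: `SlotPatternPos 4 3`. [this work] [computational] -/
theorem slotPatternPos_four_three : SahiSlot.SlotPatternPos 4 3 :=
  SahiSlot.slotPatternPos_three_iff_patternPos.2 patternPos_four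

/-- The cell `(4,3)` as the order-`n` pattern inequality `PatternPosN 3 4`. [this work] [computational] -/
theorem patternPosN_three_four : SahiGridPatternN.PatternPosN 3 4 :=
  SahiGridPatternN.patternPosN_three_iff.2 patternPos_four

end Summit.CriticalPhenomena.PercolationContinuityZ3.Theorems.SahiGridPattern
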